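import Literature.Probability.RandomPlanarGeometry.SAWSnakeRoute
import HarnessLib

/-!
# The snake route at an arbitrary radius: rewiring a walk so that it covers a cube of radius `r`

Topic `Literature/Probability/RandomPlanarGeometry`, infrastructure for Kesten's Pattern Theorem
(N. Madras, G. Slade, *The Self-Avoiding Walk* (1993), §7.2), continuing `SAWSnakeRoute.lean`, whose snake
gadget `snakeGadget i : GadgetData i 30` covers a cube of the FIXED radius `13` (the radius of the cube
`Q̄ = Q ⊕ 2` of the `(V,Q)`-routing). Madras–Slade's Lemma 7.2.6 ("almost all walks fill some cube") is
stated for the cube of an arbitrary pattern; for the applications in §8.2 (Theorem 8.2.3 (a): walks in a wedge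
with one bounded profile; (8.2.11)) one needs the covering event for cubes of ARBITRARY radius `r` — a walk
confined to a slab of width `T` never covers a cube of radius `r > T/2`. This file is the generic-radius
version of the snake gadget and of the snake route, obtained from the generic routing theorem
`exists_routeG` of `SAWSnakeRoute.lean` (the numbers `13 ↦ r`, `-14 ↦ -(r+1)`, `26 ↦ 2r`, `27 ↦ 2r+1`,
`30 ↦ 2r+4`).

## Contents (namespace `Literature.Probability.RandomPlanarGeometry.SAW.Zd`; all PROVED, no named facts)

* `snakeBaseR r i`, `snakeFarR`, `snakeTopR`, `snakeLenR` — the corners of the snake cube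
  `snakeBaseR r i + {0,…,2r}^{d+2}` (level `-(r+1)` on the axis `i`, one step off it) and the length of the
  boustrophedon snake through it (Lemma 7.2.4 (a), `snakeList (d+2) (2r)` of `SAWSnakeRoute.lean`);
* `snakeABR`, `snakeABCR`, `snakeGadgetWalkR`, `snakeGadgetLenR` and **`snakeGadgetR r i : GadgetData i (2r+4)`**
  — the snake gadget of radius `2r+4` (`lo = -(r+1)`, `hi = r`, `β = 2r+1`); `snakeGadgetR_covers`,
  `snakeCentreR`, `snakeGadgetR_marker` (the cube of radius `r` around `snakeCentreR r i` consists of gadget points);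
* `snakeRouteLen r d = (2r+1)^{d+2} + 14(2r+4)(d+2) + 1` and **`exists_snake_routeR`** — for `x ≠ y` on the outer
  layer of `c + [-(2r+4), 2r+4]^{d+2}` a self-avoiding path inside this cube from `x` to `y`, of length at most
  `snakeRouteLen r d`, with a time `t₀` such that every point at `ℓ∞`-distance `≤ r` from `π t₀` is a point of
  `π` (Lemma 7.2.4 (a),(b) at radius `r`).

## References

* N. Madras, G. Slade, *The Self-Avoiding Walk*, Birkhäuser (1993), §7.2, Lemma 7.2.4 (a),(b) (p. 234; the radius
  `r` of the cube `Q` and the covering event `E*` are fixed on p. 235) and Lemma 7.2.6 (p. 237, proof pp. 237–240).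
-/

noncomputable section

open Filter Topology Literature.Probability.LatticeModels Literature.Probability.Percolation SimpleGraph
open scoped BigOperators

namespace Literature.Probability.RandomPlanarGeometry.SAW.Zd

section SnakeGadgetR

variable {d : ℕ}

/-- The base corner of the radius-`r` snake cube: level `-(r+1)` on the axis, one step off it.
[cite: MadrasSlade1993, Lemma 7.2.4 (a)] -/
def snakeBaseR (r : ℕ) (i : Fin (d + 2)) : Site (d + 2) := Pi.single i (-((r : ℤ) + 1)) + Pi.single (snakeDir i) 1

/-- The far corner of the snake cube. [cite: MadrasSlade1993, Lemma 7.2.4 (a)] -/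
def snakeFarR (r : ℕ) (i : Fin (d + 2)) : Site (d + 2) := snakeBaseR r i + fun _ => ((2 * r : ℕ) : ℤ)

/-- The point above the far corner, where the gadget leaves the snake cube. [cite: MadrasSlade1993, Lemma 7.2.4 (a)] -/
def snakeTopR (r : ℕ) (i : Fin (d + 2)) : Site (d + 2) := snakeFarR r i + Pi.single i 1

/-- Length of the snake piece: `(2r+1)^{d+2} - 1`. [cite: MadrasSlade1993, Lemma 7.2.4 (a)] -/
def snakeLenR (r d : ℕ) : ℕ := (2 * r + 1) ^ (d + 2) - 1

/-- The level of the base corner. [cite: MadrasSlade1993, Lemma 7.2.4 (a),(b) (proof; construction step)] -/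
theorem snakeBaseR_self (r : ℕ) (i : Fin (d + 2)) : snakeBaseR r i i = -((r : ℤ) + 1) := by
  simp [snakeBaseR, Pi.single_eq_of_ne (snakeDir_ne i).symm]

/-- The transverse offset of the base corner. [cite: MadrasSlade1993, Lemma 7.2.4 (a),(b) (proof; construction step)] -/
theorem snakeBaseR_dir (r : ℕ) (i : Fin (d + 2)) : snakeBaseR r i (snakeDir i) = 1 := by
  simp [snakeBaseR, Pi.single_eq_of_ne (snakeDir_ne i)]

/-- The other coordinates of the base corner vanish. [cite: MadrasSlade1993, Lemma 7.2.4 (a),(b) (proof; construction step)] -/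
theorem snakeBaseR_other (r : ℕ) (i : Fin (d + 2)) {j : Fin (d + 2)} (hj : j ≠ i) (hj' : j ≠ snakeDir i) :
    snakeBaseR r i j = 0 := by
  simp [snakeBaseR, Pi.single_eq_of_ne hj, Pi.single_eq_of_ne hj']

/-- All coordinates of the base corner are in `[-(r+1), 1]`. [cite: MadrasSlade1993, Lemma 7.2.4 (a),(b) (proof; construction step)] -/
theorem snakeBaseR_bounds (r : ℕ) (i j : Fin (d + 2)) : -((r : ℤ) + 1) ≤ snakeBaseR r i j ∧ snakeBaseR r i j ≤ 1 := by
  by_cases hj : j = i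
  · subst hj; rw [snakeBaseR_self]; constructor <;> linarith
  by_cases hj' : j = snakeDir i
  · subst hj'; rw [snakeBaseR_dir]; constructor <;> linarith
  rw [snakeBaseR_other r i hj hj']; constructor <;> linarith

/-- The level of the exit point is `r`, its other coordinates are those of the far corner. [cite: MadrasSlade1993, Lemma 7.2.4 (a),(b) (proof; construction step)] -/
theorem snakeTopR_apply (r : ℕ) (i : Fin (d + 2)) :
    snakeTopR r i i = r ∧ ∀ j, j ≠ i → snakeTopR r i j = snakeBaseR r i j + 2 * r := by
  refine ⟨?_, fun j hj => ?_⟩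
  · simp only [snakeTopR, snakeFarR, Pi.add_apply, snakeBaseR_self, Pi.single_eq_same]; push_cast; ring
  · simp only [snakeTopR, snakeFarR, Pi.add_apply, Pi.single_eq_of_ne hj]; push_cast; ring

/-- The distance from the axis entry to the base corner is `1`. [cite: MadrasSlade1993, Lemma 7.2.4 (a),(b) (proof; construction step)] -/
theorem dist1_entry_baseR (r : ℕ) (i : Fin (d + 2)) :
    dist1 (Pi.single i (-((r : ℤ) + 1)) : Site (d + 2)) (snakeBaseR r i) = 1 := by
  have hne := snakeDir_ne i
  have hag : ∀ j, j ≠ snakeDir i → (Pi.single i (-((r : ℤ) + 1)) : Site (d + 2)) j = snakeBaseR r i j := by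
    intro j hj
    by_cases hji : j = i
    · subst hji; rw [snakeBaseR_self]; simp
    · rw [Pi.single_eq_of_ne hji, snakeBaseR_other r i hji hj]
  rw [dist1_of_agree hag, snakeBaseR_dir, Pi.single_eq_of_ne hne]; rfl

/-- The distance from the far corner to the exit point is `1`. [cite: MadrasSlade1993, Lemma 7.2.4 (a),(b) (proof; construction step)] -/
theorem dist1_far_topR (r : ℕ) (i : Fin (d + 2)) : dist1 (snakeFarR r i) (snakeTopR r i) = 1 := by
  rw [dist1_of_agree (i := i) (fun j hj => by simp [snakeTopR, Pi.single_eq_of_ne hj])]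
  simp [snakeTopR]

/-- The number of points of the snake. [cite: MadrasSlade1993, Lemma 7.2.4 (a),(b) (proof; construction step)] -/
theorem length_snakeListR (r d : ℕ) : (snakeList (d + 2) (2 * r)).length = (2 * r + 1) ^ (d + 2) := by
  rw [length_snakeList]

/-- `(2r+1)^{d+2} ≥ 1`. [cite: MadrasSlade1993, Lemma 7.2.4 (a),(b) (proof; construction step)] -/
theorem one_le_powR (r d : ℕ) : 1 ≤ (2 * r + 1) ^ (d + 2) := Nat.one_le_pow _ _ (by omega)

/-- Points of the snake piece: `base + p` with `p ∈ {0,…,2r}^{d+2}`. [cite: MadrasSlade1993, Lemma 7.2.4 (a),(b) (proof; construction step)] -/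
theorem snake_pointR (r : ℕ) (i : Fin (d + 2)) {t : ℕ} (ht : t < (2 * r + 1) ^ (d + 2)) :
    ∃ p : Site (d + 2), (∀ j, 0 ≤ p j ∧ p j ≤ ((2 * r : ℕ) : ℤ)) ∧
      siteListWalk (snakeBaseR r i) (snakeList (d + 2) (2 * r)) t = snakeBaseR r i + p := by
  refine ⟨(snakeList (d + 2) (2 * r))[t]'(by rw [length_snakeListR]; exact ht), ?_, siteListWalk_apply _⟩
  exact mem_snakeList.1 (List.getElem_mem _)

/-- The snake starts at the base corner. [cite: MadrasSlade1993, Lemma 7.2.4 (a),(b) (proof; construction step)] -/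
theorem snake_firstR (r : ℕ) (i : Fin (d + 2)) :
    siteListWalk (snakeBaseR r i) (snakeList (d + 2) (2 * r)) 0 = snakeBaseR r i := by
  rw [siteListWalk_apply (by rw [length_snakeListR]; exact one_le_powR r d)]
  have h0 := head_snakeList (d + 2) (2 * r)
  rw [List.head?_eq_getElem?, List.getElem?_eq_getElem (by rw [length_snakeListR]; exact one_le_powR r d)] at h0
  rw [Option.some_injective _ h0, add_zero]

/-- The snake ends at the far corner. [cite: MadrasSlade1993, Lemma 7.2.4 (a),(b) (proof; construction step)] -/
theorem snake_lastR (r : ℕ) (i : Fin (d + 2)) :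
    siteListWalk (snakeBaseR r i) (snakeList (d + 2) (2 * r)) (snakeLenR r d) = snakeFarR r i := by
  have h := length_snakeListR r d
  have h1 := one_le_powR r d
  rw [siteListWalk_apply (by rw [h]; unfold snakeLenR; omega)]
  have hL := getLast_snakeList (d + 2) (show (2 * r) % 2 = 0 by omega)
  rw [List.getLast?_eq_getElem?, List.getElem?_eq_getElem (by rw [h]; omega)] at hL
  have hidx : (snakeList (d + 2) (2 * r)).length - 1 = snakeLenR r d := by rw [h]; rfl
  simp only [hidx] at hL
  rw [Option.some_injective _ hL]
  rfl

/-- The pieces `A ++ B` of the snake gadget (entry step, then the snake). [cite: MadrasSlade1993, Lemma 7.2.4 (a),(b) (proof; construction step)] -/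
def snakeABR (r : ℕ) (i : Fin (d + 2)) : ℕ → Site (d + 2) :=
  pappend 1 (gpath (Pi.single i (-((r : ℤ) + 1))) (snakeBaseR r i))
    (siteListWalk (snakeBaseR r i) (snakeList (d + 2) (2 * r)))

/-- The pieces `A ++ B ++ C`. [cite: MadrasSlade1993, Lemma 7.2.4 (a),(b) (proof; construction step)] -/
def snakeABCR (r : ℕ) (i : Fin (d + 2)) : ℕ → Site (d + 2) :=
  pappend (snakeLenR r d + 1) (snakeABR r i) (gpath (snakeFarR r i) (snakeTopR r i))

/-- The four pieces of the snake gadget concatenated: axis point → base corner, the snake through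
`base + {0,…,2r}^{d+2}`, one step up from the far corner, greedy path at level `r` back to the axis.
[cite: MadrasSlade1993, Lemma 7.2.4 (a),(b)] -/
def snakeGadgetWalkR (r : ℕ) (i : Fin (d + 2)) : ℕ → Site (d + 2) :=
  pappend (snakeLenR r d + 2) (snakeABCR r i) (gpath (snakeTopR r i) (Pi.single i (r : ℤ)))

/-- Length of the snake gadget. [cite: MadrasSlade1993, Lemma 7.2.4 (a),(b) (proof; construction step)] -/
def snakeGadgetLenR (r : ℕ) (i : Fin (d + 2)) : ℕ :=
  snakeLenR r d + 2 + dist1 (snakeTopR r i) (Pi.single i (r : ℤ) : Site (d + 2))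

/-- Junction `A`/`B`. [cite: MadrasSlade1993, Lemma 7.2.4 (a),(b) (proof; construction step)] -/
theorem snake_jABR (r : ℕ) (i : Fin (d + 2)) :
    gpath (Pi.single i (-((r : ℤ) + 1)) : Site (d + 2)) (snakeBaseR r i) 1 =
      siteListWalk (snakeBaseR r i) (snakeList (d + 2) (2 * r)) 0 := by
  rw [← dist1_entry_baseR r i, gpath_of_ge _ _ le_rfl, snake_firstR]

/-- Values of `snakeABR`. [cite: MadrasSlade1993, Lemma 7.2.4 (a),(b) (proof; construction step)] -/
theorem snakeABR_apply (r : ℕ) (i : Fin (d + 2)) :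
    snakeABR r i 0 = Pi.single i (-((r : ℤ) + 1)) ∧
      ∀ k, snakeABR r i (1 + k) = siteListWalk (snakeBaseR r i) (snakeList (d + 2) (2 * r)) k := by
  refine ⟨by unfold snakeABR; rw [pappend_of_le _ _ (Nat.zero_le _), gpath_zero], fun k => ?_⟩
  unfold snakeABR
  rw [pappend_add _ _ _ _ (snake_jABR r i)]

/-- `snakeABR` is a self-avoiding path (the entry point is off the snake cube: its transverse
coordinate is `0`). [cite: MadrasSlade1993, Lemma 7.2.4 (a),(b) (proof; construction step)] -/
theorem pathOn_snakeABR (r : ℕ) (i : Fin (d + 2)) : PathOn (snakeLenR r d + 1) (snakeABR r i) := by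
  have hne := snakeDir_ne i
  have hA : PathOn 1 (gpath (Pi.single i (-((r : ℤ) + 1)) : Site (d + 2)) (snakeBaseR r i)) := by
    have := pathOn_gpath (Pi.single i (-((r : ℤ) + 1)) : Site (d + 2)) (snakeBaseR r i)
    rwa [dist1_entry_baseR] at this
  have hB : PathOn (snakeLenR r d) (siteListWalk (snakeBaseR r i) (snakeList (d + 2) (2 * r))) := by
    have := pathOn_siteListWalk (isChain_snakeList (d + 2) (show (2 * r) % 2 = 0 by omega))
      (nodup_snakeList (d + 2) (2 * r)) (snakeBaseR r i)
    rwa [length_snakeListR] at this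
  have := hA.append hB (snake_jABR r i) fun s hs t ht1 ht2 heq => ?_
  · unfold snakeABR; rwa [show 1 + snakeLenR r d = snakeLenR r d + 1 by ring] at this
  · have hs0 : s = 0 := by omega
    subst hs0
    rw [gpath_zero] at heq
    obtain ⟨p, hp, e⟩ := snake_pointR r i (show t < (2 * r + 1) ^ (d + 2) by
      unfold snakeLenR at ht2; have := one_le_powR r d; omega)
    rw [e] at heq
    have := congrFun heq (snakeDir i)
    rw [Pi.add_apply, snakeBaseR_dir, Pi.single_eq_of_ne hne] at this
    have := (hp (snakeDir i)).1
    omega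

/-- Levels and coordinates of the points of `snakeABR`. [cite: MadrasSlade1993, Lemma 7.2.4 (a),(b) (proof; construction step)] -/
theorem snakeABR_ranges (r : ℕ) (i : Fin (d + 2)) {s : ℕ} (hs : s ≤ snakeLenR r d + 1) :
    (-((r : ℤ) + 1) ≤ snakeABR r i s i ∧ snakeABR r i s i ≤ (r : ℤ) - 1) ∧ ∀ j, |snakeABR r i s j| ≤ 2 * r + 1 := by
  obtain ⟨h0, hk⟩ := snakeABR_apply r i
  rcases Nat.eq_zero_or_pos s with rfl | hpos
  · rw [h0]
    have hr : (0 : ℤ) ≤ r := Nat.cast_nonneg r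
    refine ⟨by rw [Pi.single_eq_same]; constructor <;> linarith, fun j => ?_⟩
    by_cases hj : j = i
    · subst hj; rw [Pi.single_eq_same, abs_le]; constructor <;> linarith
    · rw [Pi.single_eq_of_ne hj, abs_zero]; linarith
  · obtain ⟨k, rfl⟩ : ∃ k, s = 1 + k := ⟨s - 1, by omega⟩
    rw [hk k]
    obtain ⟨p, hp, e⟩ := snake_pointR r i (show k < (2 * r + 1) ^ (d + 2) by
      unfold snakeLenR at hs; have := one_le_powR r d; omega)
    rw [e]
    refine ⟨?_, fun j => ?_⟩
    · rw [Pi.add_apply, snakeBaseR_self]; have := hp i; push_cast at this; omega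
    · rw [Pi.add_apply, abs_le]; have h1 := hp j; have h2 := snakeBaseR_bounds r i j; push_cast at h1; omega

/-- Junction `B`/`C`. [cite: MadrasSlade1993, Lemma 7.2.4 (a),(b) (proof; construction step)] -/
theorem snake_jCR (r : ℕ) (i : Fin (d + 2)) :
    snakeABR r i (snakeLenR r d + 1) = gpath (snakeFarR r i) (snakeTopR r i) 0 := by
  rw [show snakeLenR r d + 1 = 1 + snakeLenR r d by ring, (snakeABR_apply r i).2, snake_lastR, gpath_zero]

/-- `snakeABCR` is a self-avoiding path (the exit point has level `r`, above the snake cube). [cite: MadrasSlade1993, Lemma 7.2.4 (a),(b) (proof; construction step)] -/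
theorem pathOn_snakeABCR (r : ℕ) (i : Fin (d + 2)) : PathOn (snakeLenR r d + 2) (snakeABCR r i) := by
  have hC : PathOn 1 (gpath (snakeFarR r i) (snakeTopR r i)) := by
    have := pathOn_gpath (snakeFarR r i) (snakeTopR r i); rwa [dist1_far_topR] at this
  have := (pathOn_snakeABR r i).append hC (snake_jCR r i) fun s hs t ht1 ht2 heq => ?_
  · unfold snakeABCR; exact this
  · have ht : t = 1 := by omega
    subst ht
    rw [← dist1_far_topR r i, gpath_of_ge _ _ le_rfl] at heq
    have h1 := (snakeABR_ranges r i hs.le).1.2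
    rw [heq, (snakeTopR_apply r i).1] at h1
    linarith

/-- Values of `snakeABCR`. [cite: MadrasSlade1993, Lemma 7.2.4 (a),(b) (proof; construction step)] -/
theorem snakeABCR_apply (r : ℕ) (i : Fin (d + 2)) :
    (∀ s ≤ snakeLenR r d + 1, snakeABCR r i s = snakeABR r i s) ∧ snakeABCR r i (snakeLenR r d + 2) = snakeTopR r i := by
  refine ⟨fun s hs => by unfold snakeABCR; rw [pappend_of_le _ _ hs], ?_⟩
  unfold snakeABCR
  rw [show snakeLenR r d + 2 = (snakeLenR r d + 1) + 1 by ring, pappend_add _ _ _ _ (snake_jCR r i),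
    ← dist1_far_topR r i, gpath_of_ge _ _ le_rfl]

/-- Junction `C`/`D`. [cite: MadrasSlade1993, Lemma 7.2.4 (a),(b) (proof; construction step)] -/
theorem snake_jDR (r : ℕ) (i : Fin (d + 2)) :
    snakeABCR r i (snakeLenR r d + 2) = gpath (snakeTopR r i) (Pi.single i (r : ℤ)) 0 := by
  rw [(snakeABCR_apply r i).2, gpath_zero]

/-- Piece `D` stays at level `r`; its coordinates lie between those of the exit point and `0`. [cite: MadrasSlade1993, Lemma 7.2.4 (a),(b) (proof; construction step)] -/
theorem snakeDR_spec (r : ℕ) (i : Fin (d + 2)) (k : ℕ) :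
    gpath (snakeTopR r i) (Pi.single i (r : ℤ) : Site (d + 2)) k i = r ∧
      ∀ j, |gpath (snakeTopR r i) (Pi.single i (r : ℤ) : Site (d + 2)) k j| ≤ 2 * r + 1 := by
  obtain ⟨htop, hoth⟩ := snakeTopR_apply r i
  refine ⟨by rw [gpath_apply_of_eq (by rw [htop]; simp), htop], fun j => ?_⟩
  have hmem := gpath_apply_mem (snakeTopR r i) (Pi.single i (r : ℤ) : Site (d + 2)) j k
  by_cases hj : j = i
  · subst hj; rw [htop, Pi.single_eq_same] at hmem; rw [abs_le]; omega
  · rw [hoth j hj, Pi.single_eq_of_ne hj] at hmem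
    have := snakeBaseR_bounds r i j
    rw [abs_le]; omega

/-- **The snake gadget of radius `2r+4` is a gadget** for the axis `i` (`lo = -(r+1)`, `hi = r`, `β = 2r+1`).
[cite: MadrasSlade1993, Lemma 7.2.4 (a),(b)] -/
def snakeGadgetR (r : ℕ) (i : Fin (d + 2)) : GadgetData i (2 * (r : ℤ) + 4) where
  g := snakeGadgetWalkR r i
  len := snakeGadgetLenR r i
  lo := -((r : ℤ) + 1)
  hi := r
  β := 2 * r + 1
  pathOn := by
    have := (pathOn_snakeABCR r i).append (pathOn_gpath (snakeTopR r i) (Pi.single i (r : ℤ))) (snake_jDR r i)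
      fun s hs t ht1 ht2 heq => ?_
    · exact this
    · have hr := (snakeDR_spec r i t).1
      rcases Nat.lt_or_ge s (snakeLenR r d + 2) with h | h
      · rw [(snakeABCR_apply r i).1 s (by omega)] at heq
        have := (snakeABR_ranges r i (s := s) (by omega)).1.2
        rw [heq, hr] at this
        linarith
      · omega
  g_zero := by
    show snakeGadgetWalkR r i 0 = _
    unfold snakeGadgetWalkR
    rw [pappend_of_le _ _ (Nat.zero_le _), (snakeABCR_apply r i).1 0 (Nat.zero_le _), (snakeABR_apply r i).1]
  g_len := by
    show snakeGadgetWalkR r i (snakeGadgetLenR r i) = _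
    unfold snakeGadgetWalkR snakeGadgetLenR
    rw [pappend_add _ _ _ _ (snake_jDR r i), gpath_of_ge _ _ le_rfl]
  ranges := by
    intro t ht
    show (-((r : ℤ) + 1) ≤ snakeGadgetWalkR r i t i ∧ snakeGadgetWalkR r i t i ≤ r) ∧
      ∀ j, |snakeGadgetWalkR r i t j| ≤ 2 * r + 1
    unfold snakeGadgetWalkR
    rcases le_or_gt t (snakeLenR r d + 2) with h | h
    · rw [pappend_of_le _ _ h]
      rcases h.lt_or_eq with h' | rfl
      · rw [(snakeABCR_apply r i).1 t (by omega)]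
        have := snakeABR_ranges r i (show t ≤ snakeLenR r d + 1 by omega)
        exact ⟨⟨this.1.1, by linarith [this.1.2]⟩, this.2⟩
      · rw [(snakeABCR_apply r i).2]
        have hr : (0 : ℤ) ≤ r := Nat.cast_nonneg r
        obtain ⟨htop, hoth⟩ := snakeTopR_apply r i
        refine ⟨by rw [htop]; constructor <;> linarith, fun j => ?_⟩
        by_cases hj : j = i
        · subst hj; rw [htop, abs_le]; constructor <;> linarith
        · rw [hoth j hj, abs_le]; have := snakeBaseR_bounds r i j; omega
    · obtain ⟨k, rfl⟩ : ∃ k, t = snakeLenR r d + 2 + k := ⟨t - (snakeLenR r d + 2), by omega⟩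
      rw [pappend_add _ _ _ _ (snake_jDR r i)]
      have hr : (0 : ℤ) ≤ r := Nat.cast_nonneg r
      have := snakeDR_spec r i k
      exact ⟨by rw [this.1]; constructor <;> linarith, this.2⟩
  bounds := by
    have hr : (0 : ℤ) ≤ r := Nat.cast_nonneg r
    exact ⟨by linarith, by linarith, by linarith, by linarith, by linarith⟩

/-- Every point of the snake cube `base + {0,…,2r}^{d+2}` is a point of the snake gadget. [cite: MadrasSlade1993, Lemma 7.2.4 (a),(b) (proof; construction step)] -/
theorem snakeGadgetR_covers (r : ℕ) (i : Fin (d + 2)) (z : Site (d + 2))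
    (hz : ∀ j, 0 ≤ z j - snakeBaseR r i j ∧ z j - snakeBaseR r i j ≤ 2 * r) :
    ∃ t ≤ (snakeGadgetR r i).len, (snakeGadgetR r i).g t = z := by
  have hmem : (z - snakeBaseR r i) ∈ snakeList (d + 2) (2 * r) := mem_snakeList.2 fun j => by
    have := hz j; rw [Pi.sub_apply]; push_cast; exact this
  obtain ⟨k, hk, e⟩ := List.getElem_of_mem hmem
  rw [length_snakeListR] at hk
  refine ⟨1 + k, ?_, ?_⟩
  · show 1 + k ≤ snakeGadgetLenR r i
    unfold snakeGadgetLenR snakeLenR; omega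
  · show snakeGadgetWalkR r i (1 + k) = z
    unfold snakeGadgetWalkR
    rw [pappend_of_le _ _ (by unfold snakeLenR; omega), (snakeABCR_apply r i).1 _ (by unfold snakeLenR; omega),
      (snakeABR_apply r i).2 k, siteListWalk_apply (by rw [length_snakeListR]; exact hk), e]
    abel

/-- The centre of the snake cube. [cite: MadrasSlade1993, Lemma 7.2.4 (a),(b) (proof; construction step)] -/
def snakeCentreR (r : ℕ) (i : Fin (d + 2)) : Site (d + 2) := snakeBaseR r i + fun _ => (r : ℤ)

/-- The cube of radius `r` around the centre of the snake cube consists of gadget points; the centre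
itself is the gadget point used as marker. [cite: MadrasSlade1993, Lemma 7.2.6 (proof)] -/
theorem snakeGadgetR_marker (r : ℕ) (i : Fin (d + 2)) :
    (∃ t ≤ (snakeGadgetR r i).len, (snakeGadgetR r i).g t = snakeCentreR r i) ∧
      ∀ z : Site (d + 2), (∀ j, |z j - snakeCentreR r i j| ≤ r) →
        ∃ t ≤ (snakeGadgetR r i).len, (snakeGadgetR r i).g t = z := by
  have hr : (0 : ℤ) ≤ r := Nat.cast_nonneg r
  refine ⟨snakeGadgetR_covers r i _ fun j => by
      simp only [snakeCentreR, Pi.add_apply, add_sub_cancel_left]; constructor <;> linarith,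
    fun z hz => snakeGadgetR_covers r i z fun j => ?_⟩
  have := hz j
  simp only [snakeCentreR, Pi.add_apply] at this
  rw [abs_le] at this
  omega

/-- The length bound of the snake route of radius `r` (`= (2r+1)^{d+2} + 14(2r+4)(d+2) + 1`).
[cite: MadrasSlade1993, Lemma 7.2.6 (proof), "bounded above by the number of steps required to visit every
point in the cube"] -/
def snakeRouteLen (r d : ℕ) : ℕ := (2 * r + 1) ^ (d + 2) + 14 * (2 * r + 4) * (d + 2) + 1

/-- **The snake route at radius `r`.** For `x ≠ y` on the outer layer of `c + [-(2r+4),2r+4]^{d+2}` there is a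
self-avoiding path inside this cube from `x` to `y`, of length at most `snakeRouteLen r d`, one of whose points
`π t₀` is the centre of a cube of radius `r` all of whose points are points of `π` (the path "completely
covers" that cube — the covering event of Madras–Slade's Lemma 7.2.6 for a cube of radius `r`).
[cite: MadrasSlade1993, Lemma 7.2.4 and Lemma 7.2.6 (proof)] -/
theorem exists_snake_routeR (r : ℕ) (c x y : Site (d + 2)) (hx : ∀ j, |x j - c j| ≤ 2 * (r : ℤ) + 4)
    (hxL : ∃ j, |x j - c j| = 2 * (r : ℤ) + 4) (hy : ∀ j, |y j - c j| ≤ 2 * (r : ℤ) + 4)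
    (hyL : ∃ j, |y j - c j| = 2 * (r : ℤ) + 4) (hne : x ≠ y) :
    ∃ (L : ℕ) (π : ℕ → Site (d + 2)), L ≤ snakeRouteLen r d ∧ π 0 = x ∧ π L = y ∧
      PathOn L π ∧ (∀ t ≤ L, ∀ j, |π t j - c j| ≤ 2 * (r : ℤ) + 4) ∧
      ∃ t₀ ≤ L, ∀ z : Site (d + 2), (∀ j, |z j - π t₀ j| ≤ r) → ∃ t ≤ L, π t = z := by
  have hΛ : ∀ i : Fin (d + 2), (snakeGadgetR r i).len ≤ (2 * r + 1) ^ (d + 2) + 2 * (2 * r + 4) * (d + 2) + 1 := by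
    intro i
    show snakeGadgetLenR r i ≤ _
    unfold snakeGadgetLenR snakeLenR
    have hb : InBoxR (2 * (r : ℤ) + 4) (snakeTopR r i) := fun j => by
      have hr : (0 : ℤ) ≤ r := Nat.cast_nonneg r
      obtain ⟨htop, hoth⟩ := snakeTopR_apply r i
      by_cases hj : j = i
      · subst hj; rw [htop, abs_le]; constructor <;> linarith
      · rw [hoth j hj, abs_le]; have := snakeBaseR_bounds r i j; omega
    have hr : (0 : ℤ) ≤ r := Nat.cast_nonneg r
    have hb' : InBoxR (2 * (r : ℤ) + 4) (Pi.single i (r : ℤ) : Site (d + 2)) := fun j => by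
      by_cases hj : j = i
      · subst hj; rw [Pi.single_eq_same, abs_le]; constructor <;> linarith
      · rw [Pi.single_eq_of_ne hj, abs_zero]; linarith
    have := dist1_le_of_inBoxR hb hb'
    have h1 := one_le_powR r d
    zify [h1]
    nlinarith
  obtain ⟨L, π, hL, h0, hend, hP, hbox, i, hg⟩ :=
    exists_routeG (fun i => snakeGadgetR r i) hΛ c x y hx hxL hy hyL hne
  refine ⟨L, π, ?_, h0, hend, hP, hbox, ?_⟩
  · unfold snakeRouteLen
    zify
    push_cast at hL ⊢
    nlinarith
  obtain ⟨⟨tc, htc, etc⟩, hcov⟩ := snakeGadgetR_marker r i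
  obtain ⟨t₀, ht₀, e₀⟩ := hg tc htc
  refine ⟨t₀, ht₀, fun z hz => ?_⟩
  have hz' : ∀ j, |(z - c) j - snakeCentreR r i j| ≤ r := fun j => by
    have := hz j; rw [e₀, etc] at this; simpa [sub_sub] using this
  obtain ⟨k, hk, ek⟩ := hcov (z - c) hz'
  obtain ⟨t, ht, et⟩ := hg k hk
  exact ⟨t, ht, by rw [et, ek]; abel⟩

end SnakeGadgetR

end Literature.Probability.RandomPlanarGeometry.SAW.Zd
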